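import Mathlib
import HarnessLib
import Summits.HubbardSuperconductivity.HubbardSuperconductivity.Theorems.KLProgrammeKLRegimeEnginePairTransferPHSignedGeneric
import Summits.HubbardSuperconductivity.HubbardSuperconductivity.Theorems.KLProgrammeKLRegimeSplitEdgeFactsWindowedMass

/-!
# Route `KLProgramme` — ENGINE item stmt-HubbardSuperconductivity-20437 `KLRegimeEngineV17F2`, located-risk #9 «ZS-L1» (pen (R278)(B)), consumer side:
# THE WINDOW-SUPPORTED ROW — the literal signed direct / crossed PH rows for a kernel SUPPORTED IN A TORUS WINDOW of the loop momentum,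
# bounded by the kernel's sup times the WINDOWED soft mass of the partner weight (cell gate-hubbard-kl, seat hubbard-kl-k3c2-p2 g21)

WHY.  The dressed part `F₂` of the class-#1 kernel split `V⊗V = λ̄² + F₁ + F₂` (design memo ZS-L1-DESIGN.md on the item; `F₂` = sup `a₂X`, supported in torus
balls of radius `c_w·Λₙ₊₁` around the external legs' points) cannot be booked as a FLAT cubic (located «(A25)-FLAT-HOST-VS-CHILD1»: a flat cubic per step breaks
child 1's `U²` budget).  It must be booked WITH ITS SUPPORT: the Hölder bound of the flat remainder of `klms_weighted_direct_norm_le` (…PairTransferPHSignedGeneric)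
restricted to the window where the kernel lives, read by the WINDOWED soft mass `sum_window_softSymbol_mul_norm_propCT_le` (…SplitEdgeFactsWindowedMass:
`Σ_{|p_{k−x}|_𝕋 ≤ ρ} |φ k|‖ĝ_K k‖ ≤ 15381(ρ/π + 1/L)·Λ_m·βL²`).  With `ρ = c_w·Λₙ₊₁` the row is `cubic × (4^{−(n+1)} + 1/L)` — an `erem`-shaped entry, not a flat one.

WHAT (all proved, generic in the partner weight `w : FreqMomentum → ℝ` — member `Φ_j(t)`, `D`-line `s_{n+1,j} − s_{n+1,j′}`, …):
* `sum_abs_ite_or_mul_le` — `Σ_i |𝟙[P₁ ∨ P₂]·w|·g ≤ Σ_{P₁}|w|g + Σ_{P₂}|w|g` (`g ≥ 0`);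
* **`klms_weighted_direct_norm_le_of_support`** — literal direct-row sum `S` (same summand as `klms_weighted_direct_norm_le`), kernel `F` with `‖F‖ ≤ A` and
  `F p σ p′ = 0` unless `|p.2 − c|_𝕋 ≤ ρ`:  `‖S‖ ≤ A·(512/3)(βL²)²/Λ(t)²·(Σ_{|k−c|≤ρ}|w|‖ĝ‖ + Σ_{|k−(c+(x−y))|≤ρ}|w|‖ĝ‖)` (no line identity `hwd`, no pin, no
  frequency window needed);
* **`klms_weighted_crossed_norm_le_of_support`** — the crossed twin (constraint `ω′ + 2ω₀ + 1 = ω`, `k′ = k + Qm − x − y`; constant `256/3`; second window centred at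
  `c + (Qm − x − y)`);
* `klms_weighted_direct_norm_le_of_support_soft` / `klms_weighted_crossed_norm_le_of_support_soft` — the same read by the windowed soft mass for a weight
  `0 ≤ w ≤ 1 − w^K_{Λ_m}` under `FrameOK`, `klBetaMin ≤ β ≤ L`:  `‖S‖ ≤ A·(C/3)(βL²)²/Λ(t)²·(2·15381(ρ/π + 1/L)·Λ_m·βL²)`;
* `window_flat_le` — the door's normalisation: `(Λₙ−Λₙ₊₁)((βL²)³)⁻¹·(A·(C(βL²)²/Λ(t)²·(2·15381(ρ/π+1/L)Λ_mβL²))) ≤ A·(1024·15381)·(ρ/π + 1/L)` for `C ≤ 512/3`,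
  `n+1 ≤ m`.
Pure composition over landed rows (`direct_mass_le_softSum`, `crossed_mass_le_softSum`, `sum_window_softSymbol_mul_norm_propCT_le`); nothing about the model's
effective action or the class-#1 kernel is asserted; nothing asserts (X).3, (c), K3 or superconductivity.  0 kit · 0 lit.
-/

noncomputable section

namespace Summit.HubbardSuperconductivity.HubbardSuperconductivity.Theorems.KLRegimeSplit

set_option linter.dupNamespace false -- summit = problem name (single-conjunct summit), D-0017

open Real Set Finset Complex Literature.MathematicalPhysics.QuantumLattice
open Literature.Probability.LatticeModels hiding torusSupNorm
open Summit.HubbardSuperconductivity.HubbardSuperconductivity.Theorems.KLProgrammeLegKernels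
open Summit.HubbardSuperconductivity.HubbardSuperconductivity.Theorems.KLRegimeWick
open Summit.HubbardSuperconductivity.HubbardSuperconductivity.Theorems.TwoPointAssembly
open Summit.HubbardSuperconductivity.HubbardSuperconductivity.Theorems.DispersionFlow

/-! ## §0 A windowed weight sums over its two windows -/

/-- `Σ_i |𝟙[P₁ i ∨ P₂ i]·w i|·g i ≤ Σ_{P₁} |w|g + Σ_{P₂} |w|g` for `g ≥ 0`. -/
theorem sum_abs_ite_or_mul_le {ι : Type*} [Fintype ι] (P₁ P₂ : ι → Prop) [DecidablePred P₁] [DecidablePred P₂]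
    (w g : ι → ℝ) (hg : ∀ i, 0 ≤ g i) :
    ∑ i, |(if P₁ i ∨ P₂ i then w i else 0)| * g i ≤
      ∑ i ∈ (univ : Finset ι).filter P₁, |w i| * g i + ∑ i ∈ (univ : Finset ι).filter P₂, |w i| * g i := by
  rw [Finset.sum_filter, Finset.sum_filter, ← Finset.sum_add_distrib]
  refine Finset.sum_le_sum fun i _ => ?_
  have h0 : 0 ≤ |w i| * g i := mul_nonneg (abs_nonneg _) (hg i)
  by_cases h1 : P₁ i
  · by_cases h2 : P₂ i
    · simp only [h1, h2, or_self, if_true]; linarith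
    · simp only [h1, h2, or_false, if_true, if_false, add_zero]; exact le_rfl
  · by_cases h2 : P₂ i
    · simp only [h1, h2, or_true, if_true, if_false, zero_add]; exact le_rfl
    · simp only [h1, h2, or_self, if_false, abs_zero, zero_mul, add_zero]; exact le_rfl

variable {L M : ℕ} [NeZero L] [NeZero M] (β μ : ℝ) (K : TrigPolyC4v)

/-! ## §1 The direct row for a window-supported kernel -/

/-- **WINDOW-SUPPORTED DIRECT ROW.**  Partner weight `w` (no line identity needed), slice `Ẇ_{Λ(t)}` (pin `hWd`), resolved kernel `F` with `‖F‖ ≤ A` supported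
in the loop-momentum window `|p.2 − c|_𝕋 ≤ ρ`:  `‖S‖ ≤ A·(512/3)(βL²)²/Λ(t)²·(Σ_{|k−c|_𝕋≤ρ}|w|‖ĝ‖ + Σ_{|k−(c+(x−y))|_𝕋≤ρ}|w|‖ĝ‖)`. -/
theorem klms_weighted_direct_norm_le_of_support (hβ : 0 < β) (n : ℕ) {t : ℝ} (ht : t ∈ Icc (0 : ℝ) 1)
    (w : FreqMomentum L M → ℝ)
    (Wd : ℝ → FreqMomentum L M → ℝ) (hWd : Wd = fun t k => deriv (fun Λ' : ℝ => hubbardCutoffWeightCT L M β μ K Λ' k) (klScale klE0 n + t * (klScale klE0 (n + 1) - klScale klE0 n)))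
    (F : FreqMomentum L M → Fin 2 → FreqMomentum L M → ℂ) (x y c : TorusSite 2 L) (ρ : ℝ) {A : ℝ} (hA : 0 ≤ A)
    (hF : ∀ (p : FreqMomentum L M) (σ : Fin 2) (p' : FreqMomentum L M), ‖F p σ p'‖ ≤ A)
    (hsupp : ∀ (p : FreqMomentum L M) (σ : Fin 2) (p' : FreqMomentum L M), ρ < klTorusNorm L (p.2 - c) → F p σ p' = 0) :
    ‖∑ p : FreqMomentum L M, ∑ σ : Fin 2, ∑ p' : FreqMomentum L M,
        if matsubaraInt M p'.1 + matsubaraInt M (omega0 M) = matsubaraInt M p.1 + matsubaraInt M (omega0 M) ∧ p'.2 = p.2 + x - y then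
          ((((((w p) : ℝ) : ℂ) * (((β * (L : ℝ) ^ 2 : ℝ) : ℂ) * propCT L M β μ K p)) * ((((Wd t p') : ℝ) : ℂ) * (((β * (L : ℝ) ^ 2 : ℝ) : ℂ) * propCT L M β μ K p'))) +
              (((((Wd t p) : ℝ) : ℂ) * (((β * (L : ℝ) ^ 2 : ℝ) : ℂ) * propCT L M β μ K p)) * ((((w p') : ℝ) : ℂ) * (((β * (L : ℝ) ^ 2 : ℝ) : ℂ) * propCT L M β μ K p')))) *
            F p σ p'
        else 0‖ ≤
      A * (512 / 3 * (β * (L : ℝ) ^ 2) ^ 2 / (klScale klE0 n + t * (klScale klE0 (n + 1) - klScale klE0 n)) ^ 2 *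
        (∑ p ∈ (univ : Finset (FreqMomentum L M)).filter (fun p => klTorusNorm L (p.2 - c) ≤ ρ), |w p| * ‖propCT L M β μ K p‖ +
          ∑ p ∈ (univ : Finset (FreqMomentum L M)).filter (fun p => klTorusNorm L (p.2 - (c + (x - y))) ≤ ρ), |w p| * ‖propCT L M β μ K p‖)) := by
  classical
  set Λt : ℝ := klScale klE0 n + t * (klScale klE0 (n + 1) - klScale klE0 n) with hΛt
  obtain ⟨hlo, hhi⟩ := scaleAt_mem n ht
  have hΛpos : 0 < Λt := (klth_klScale_pos (n + 1)).trans_le hlo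
  set G : FreqMomentum L M → ℂ := fun p => (((β * (L : ℝ) ^ 2 : ℝ)) : ℂ) * propCT L M β μ K p with hG
  set wt : FreqMomentum L M → ℝ := fun p =>
    if klTorusNorm L (p.2 - c) ≤ ρ ∨ klTorusNorm L (p.2 - (c + (x - y))) ≤ ρ then w p else 0 with hwt
  set ln : FreqMomentum L M → FreqMomentum L M → ℂ := fun p p' =>
    (((wt p : ℝ)) : ℂ) * G p * ((((Wd t p' : ℝ)) : ℂ) * G p') + (((Wd t p : ℝ)) : ℂ) * G p * ((((wt p' : ℝ)) : ℂ) * G p') with hln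
  set C : FreqMomentum L M → FreqMomentum L M → Prop := fun p p' =>
    matsubaraInt M p'.1 + matsubaraInt M (omega0 M) = matsubaraInt M p.1 + matsubaraInt M (omega0 M) ∧ p'.2 = p.2 + x - y with hC
  -- Step 1: on the support of `F` the weight `w` may be replaced by its windowed copy `wt`
  have hgoal : (∑ p : FreqMomentum L M, ∑ σ : Fin 2, ∑ p' : FreqMomentum L M,
        if matsubaraInt M p'.1 + matsubaraInt M (omega0 M) = matsubaraInt M p.1 + matsubaraInt M (omega0 M) ∧ p'.2 = p.2 + x - y then
          ((((((w p) : ℝ) : ℂ) * (((β * (L : ℝ) ^ 2 : ℝ) : ℂ) * propCT L M β μ K p)) * ((((Wd t p') : ℝ) : ℂ) * (((β * (L : ℝ) ^ 2 : ℝ) : ℂ) * propCT L M β μ K p'))) +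
              (((((Wd t p) : ℝ) : ℂ) * (((β * (L : ℝ) ^ 2 : ℝ) : ℂ) * propCT L M β μ K p)) * ((((w p') : ℝ) : ℂ) * (((β * (L : ℝ) ^ 2 : ℝ) : ℂ) * propCT L M β μ K p')))) *
            F p σ p'
        else 0) =
      ∑ p : FreqMomentum L M, ∑ σ : Fin 2, ∑ p' : FreqMomentum L M, if C p p' then ln p p' * F p σ p' else 0 := by
    refine Finset.sum_congr rfl fun p _ => Finset.sum_congr rfl fun σ _ => Finset.sum_congr rfl fun p' _ => ?_
    simp only [hC]
    split_ifs with hc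
    · by_cases hz : F p σ p' = 0
      · rw [hz, mul_zero, mul_zero]
      · have hin : klTorusNorm L (p.2 - c) ≤ ρ := not_lt.mp fun h => hz (hsupp p σ p' h)
        have hin' : klTorusNorm L (p'.2 - (c + (x - y))) ≤ ρ := by
          have e : p'.2 - (c + (x - y)) = p.2 - c := by rw [hc.2]; abel
          rw [e]; exact hin
        have h1 : wt p = w p := by simp only [hwt]; exact if_pos (Or.inl hin)
        have h2 : wt p' = w p' := by simp only [hwt]; exact if_pos (Or.inr hin')
        simp only [hln, hG, h1, h2]
    · rfl
  rw [hgoal]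
  -- Step 2: Hölder against the sup of the kernel
  have hterm : ∀ (p : FreqMomentum L M) (σ : Fin 2) (p' : FreqMomentum L M),
      ‖(if C p p' then ln p p' * F p σ p' else 0)‖ ≤ A * (if C p p' then ‖ln p p'‖ else 0) := by
    intro p σ p'
    split_ifs with hc
    · rw [norm_mul, mul_comm]
      exact mul_le_mul_of_nonneg_right (hF p σ p') (norm_nonneg _)
    · simp
  have hwin : ∑ p : FreqMomentum L M, |wt p| * ‖propCT L M β μ K p‖ ≤
      ∑ p ∈ (univ : Finset (FreqMomentum L M)).filter (fun p => klTorusNorm L (p.2 - c) ≤ ρ), |w p| * ‖propCT L M β μ K p‖ +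
        ∑ p ∈ (univ : Finset (FreqMomentum L M)).filter (fun p => klTorusNorm L (p.2 - (c + (x - y))) ≤ ρ), |w p| * ‖propCT L M β μ K p‖ := by
    simp only [hwt]
    exact sum_abs_ite_or_mul_le (fun p : FreqMomentum L M => klTorusNorm L (p.2 - c) ≤ ρ)
      (fun p : FreqMomentum L M => klTorusNorm L (p.2 - (c + (x - y))) ≤ ρ) w (fun p => ‖propCT L M β μ K p‖) fun p => norm_nonneg _
  have hcoef : 0 ≤ 512 / 3 * (β * (L : ℝ) ^ 2) ^ 2 / Λt ^ 2 := by positivity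
  calc ‖∑ p : FreqMomentum L M, ∑ σ : Fin 2, ∑ p' : FreqMomentum L M, (if C p p' then ln p p' * F p σ p' else 0)‖
      ≤ ∑ p : FreqMomentum L M, ∑ σ : Fin 2, ∑ p' : FreqMomentum L M, A * (if C p p' then ‖ln p p'‖ else 0) :=
        (norm_sum_le _ _).trans (Finset.sum_le_sum fun p _ => (norm_sum_le _ _).trans (Finset.sum_le_sum fun σ _ =>
          (norm_sum_le _ _).trans (Finset.sum_le_sum fun p' _ => hterm p σ p')))
    _ = A * ∑ p : FreqMomentum L M, ∑ _σ : Fin 2, ∑ p' : FreqMomentum L M, (if C p p' then ‖ln p p'‖ else 0) := by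
        simp only [Finset.mul_sum]
    _ ≤ A * (512 / 3 * (β * (L : ℝ) ^ 2) ^ 2 / Λt ^ 2 * ∑ p : FreqMomentum L M, |wt p| * ‖propCT L M β μ K p‖) := by
        refine mul_le_mul_of_nonneg_left ?_ hA
        have h := direct_mass_le_softSum β μ K hβ hΛpos wt x y
        subst hWd
        simpa only [hC, hln, hG] using h
    _ ≤ A * (512 / 3 * (β * (L : ℝ) ^ 2) ^ 2 / Λt ^ 2 *
        (∑ p ∈ (univ : Finset (FreqMomentum L M)).filter (fun p => klTorusNorm L (p.2 - c) ≤ ρ), |w p| * ‖propCT L M β μ K p‖ +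
          ∑ p ∈ (univ : Finset (FreqMomentum L M)).filter (fun p => klTorusNorm L (p.2 - (c + (x - y))) ≤ ρ), |w p| * ‖propCT L M β μ K p‖)) :=
        mul_le_mul_of_nonneg_left (mul_le_mul_of_nonneg_left hwin hcoef) hA

/-! ## §2 The crossed row for a window-supported kernel -/

/-- **WINDOW-SUPPORTED CROSSED ROW** (constraint `ω′ + 2ω₀ + 1 = ω`, `k′ = k + Qm − x − y`): `‖S‖ ≤ A·(256/3)(βL²)²/Λ(t)²·(Σ_{|k−c|_𝕋≤ρ}|w|‖ĝ‖ +
Σ_{|k−(c+(Qm−x−y))|_𝕋≤ρ}|w|‖ĝ‖)` for a kernel `F` with `‖F‖ ≤ A` supported in `|p.2 − c|_𝕋 ≤ ρ`. -/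
theorem klms_weighted_crossed_norm_le_of_support (hβ : 0 < β) (n : ℕ) {t : ℝ} (ht : t ∈ Icc (0 : ℝ) 1)
    (w : FreqMomentum L M → ℝ)
    (Wd : ℝ → FreqMomentum L M → ℝ) (hWd : Wd = fun t k => deriv (fun Λ' : ℝ => hubbardCutoffWeightCT L M β μ K Λ' k) (klScale klE0 n + t * (klScale klE0 (n + 1) - klScale klE0 n)))
    (F : FreqMomentum L M → FreqMomentum L M → ℂ) (Qm x y c : TorusSite 2 L) (ρ : ℝ) {A : ℝ} (hA : 0 ≤ A)
    (hF : ∀ (p p' : FreqMomentum L M), ‖F p p'‖ ≤ A)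
    (hsupp : ∀ (p p' : FreqMomentum L M), ρ < klTorusNorm L (p.2 - c) → F p p' = 0) :
    ‖∑ p : FreqMomentum L M, ∑ p' : FreqMomentum L M,
        if matsubaraInt M p'.1 + matsubaraInt M (omega0 M) + matsubaraInt M (omega0 M) + 1 = matsubaraInt M p.1 ∧ p'.2 = p.2 + Qm - x - y then
          ((((((w p) : ℝ) : ℂ) * (((β * (L : ℝ) ^ 2 : ℝ) : ℂ) * propCT L M β μ K p)) * ((((Wd t p') : ℝ) : ℂ) * (((β * (L : ℝ) ^ 2 : ℝ) : ℂ) * propCT L M β μ K p'))) +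
              (((((Wd t p) : ℝ) : ℂ) * (((β * (L : ℝ) ^ 2 : ℝ) : ℂ) * propCT L M β μ K p)) * ((((w p') : ℝ) : ℂ) * (((β * (L : ℝ) ^ 2 : ℝ) : ℂ) * propCT L M β μ K p')))) *
            F p p'
        else 0‖ ≤
      A * (256 / 3 * (β * (L : ℝ) ^ 2) ^ 2 / (klScale klE0 n + t * (klScale klE0 (n + 1) - klScale klE0 n)) ^ 2 *
        (∑ p ∈ (univ : Finset (FreqMomentum L M)).filter (fun p => klTorusNorm L (p.2 - c) ≤ ρ), |w p| * ‖propCT L M β μ K p‖ +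
          ∑ p ∈ (univ : Finset (FreqMomentum L M)).filter (fun p => klTorusNorm L (p.2 - (c + (Qm - x - y))) ≤ ρ), |w p| * ‖propCT L M β μ K p‖)) := by
  classical
  set Λt : ℝ := klScale klE0 n + t * (klScale klE0 (n + 1) - klScale klE0 n) with hΛt
  obtain ⟨hlo, hhi⟩ := scaleAt_mem n ht
  have hΛpos : 0 < Λt := (klth_klScale_pos (n + 1)).trans_le hlo
  set G : FreqMomentum L M → ℂ := fun p => (((β * (L : ℝ) ^ 2 : ℝ)) : ℂ) * propCT L M β μ K p with hG
  set wt : FreqMomentum L M → ℝ := fun p =>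
    if klTorusNorm L (p.2 - c) ≤ ρ ∨ klTorusNorm L (p.2 - (c + (Qm - x - y))) ≤ ρ then w p else 0 with hwt
  set ln : FreqMomentum L M → FreqMomentum L M → ℂ := fun p p' =>
    (((wt p : ℝ)) : ℂ) * G p * ((((Wd t p' : ℝ)) : ℂ) * G p') + (((Wd t p : ℝ)) : ℂ) * G p * ((((wt p' : ℝ)) : ℂ) * G p') with hln
  set C : FreqMomentum L M → FreqMomentum L M → Prop := fun p p' =>
    matsubaraInt M p'.1 + matsubaraInt M (omega0 M) + matsubaraInt M (omega0 M) + 1 = matsubaraInt M p.1 ∧ p'.2 = p.2 + Qm - x - y with hC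
  have hgoal : (∑ p : FreqMomentum L M, ∑ p' : FreqMomentum L M,
        if matsubaraInt M p'.1 + matsubaraInt M (omega0 M) + matsubaraInt M (omega0 M) + 1 = matsubaraInt M p.1 ∧ p'.2 = p.2 + Qm - x - y then
          ((((((w p) : ℝ) : ℂ) * (((β * (L : ℝ) ^ 2 : ℝ) : ℂ) * propCT L M β μ K p)) * ((((Wd t p') : ℝ) : ℂ) * (((β * (L : ℝ) ^ 2 : ℝ) : ℂ) * propCT L M β μ K p'))) +
              (((((Wd t p) : ℝ) : ℂ) * (((β * (L : ℝ) ^ 2 : ℝ) : ℂ) * propCT L M β μ K p)) * ((((w p') : ℝ) : ℂ) * (((β * (L : ℝ) ^ 2 : ℝ) : ℂ) * propCT L M β μ K p')))) *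
            F p p'
        else 0) =
      ∑ p : FreqMomentum L M, ∑ p' : FreqMomentum L M, if C p p' then ln p p' * F p p' else 0 := by
    refine Finset.sum_congr rfl fun p _ => Finset.sum_congr rfl fun p' _ => ?_
    simp only [hC]
    split_ifs with hc
    · by_cases hz : F p p' = 0
      · rw [hz, mul_zero, mul_zero]
      · have hin : klTorusNorm L (p.2 - c) ≤ ρ := not_lt.mp fun h => hz (hsupp p p' h)
        have hin' : klTorusNorm L (p'.2 - (c + (Qm - x - y))) ≤ ρ := by
          have e : p'.2 - (c + (Qm - x - y)) = p.2 - c := by rw [hc.2]; abel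
          rw [e]; exact hin
        have h1 : wt p = w p := by simp only [hwt]; exact if_pos (Or.inl hin)
        have h2 : wt p' = w p' := by simp only [hwt]; exact if_pos (Or.inr hin')
        simp only [hln, hG, h1, h2]
    · rfl
  rw [hgoal]
  have hterm : ∀ (p p' : FreqMomentum L M),
      ‖(if C p p' then ln p p' * F p p' else 0)‖ ≤ A * (if C p p' then ‖ln p p'‖ else 0) := by
    intro p p'
    split_ifs with hc
    · rw [norm_mul, mul_comm]
      exact mul_le_mul_of_nonneg_right (hF p p') (norm_nonneg _)
    · simp
  have hwin : ∑ p : FreqMomentum L M, |wt p| * ‖propCT L M β μ K p‖ ≤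
      ∑ p ∈ (univ : Finset (FreqMomentum L M)).filter (fun p => klTorusNorm L (p.2 - c) ≤ ρ), |w p| * ‖propCT L M β μ K p‖ +
        ∑ p ∈ (univ : Finset (FreqMomentum L M)).filter (fun p => klTorusNorm L (p.2 - (c + (Qm - x - y))) ≤ ρ), |w p| * ‖propCT L M β μ K p‖ := by
    simp only [hwt]
    exact sum_abs_ite_or_mul_le (fun p : FreqMomentum L M => klTorusNorm L (p.2 - c) ≤ ρ)
      (fun p : FreqMomentum L M => klTorusNorm L (p.2 - (c + (Qm - x - y))) ≤ ρ) w (fun p => ‖propCT L M β μ K p‖) fun p => norm_nonneg _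
  have hcoef : 0 ≤ 256 / 3 * (β * (L : ℝ) ^ 2) ^ 2 / Λt ^ 2 := by positivity
  calc ‖∑ p : FreqMomentum L M, ∑ p' : FreqMomentum L M, (if C p p' then ln p p' * F p p' else 0)‖
      ≤ ∑ p : FreqMomentum L M, ∑ p' : FreqMomentum L M, A * (if C p p' then ‖ln p p'‖ else 0) :=
        (norm_sum_le _ _).trans (Finset.sum_le_sum fun p _ => (norm_sum_le _ _).trans (Finset.sum_le_sum fun p' _ => hterm p p'))
    _ = A * ∑ p : FreqMomentum L M, ∑ p' : FreqMomentum L M, (if C p p' then ‖ln p p'‖ else 0) := by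
        simp only [Finset.mul_sum]
    _ ≤ A * (256 / 3 * (β * (L : ℝ) ^ 2) ^ 2 / Λt ^ 2 * ∑ p : FreqMomentum L M, |wt p| * ‖propCT L M β μ K p‖) := by
        refine mul_le_mul_of_nonneg_left ?_ hA
        have h := crossed_mass_le_softSum β μ K hβ hΛpos wt Qm x y
        subst hWd
        simpa only [hC, hln, hG] using h
    _ ≤ A * (256 / 3 * (β * (L : ℝ) ^ 2) ^ 2 / Λt ^ 2 *
        (∑ p ∈ (univ : Finset (FreqMomentum L M)).filter (fun p => klTorusNorm L (p.2 - c) ≤ ρ), |w p| * ‖propCT L M β μ K p‖ +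
          ∑ p ∈ (univ : Finset (FreqMomentum L M)).filter (fun p => klTorusNorm L (p.2 - (c + (Qm - x - y))) ≤ ρ), |w p| * ‖propCT L M β μ K p‖)) :=
        mul_le_mul_of_nonneg_left (mul_le_mul_of_nonneg_left hwin hcoef) hA

/-! ## §3 Reading by the windowed soft mass (`FrameOK`, `0 ≤ w ≤ 1 − w^K_{Λ_m}`) -/

/-- **WINDOW-SUPPORTED DIRECT ROW, SOFT WEIGHT**: for `0 ≤ w ≤ 1 − w^K_{Λ_m}` (e.g. the `D`-line `s_{n+1,j} − s_{n+1,m}`, `softSymbolCompl_sub_compl_mem`) under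
`FrameOK`, `klBetaMin ≤ β ≤ L`:  `‖S‖ ≤ A·(512/3)(βL²)²/Λ(t)²·(2·(15381(ρ/π + 1/L)·Λ_m·βL²))`. -/
theorem klms_weighted_direct_norm_le_of_support_soft {R : RenConsts} {U : ℝ} {N : ℕ} (hK : FrameOK R U N μ K) (hβ : klBetaMin ≤ β) (hβL : β ≤ L)
    (n m : ℕ) {t : ℝ} (ht : t ∈ Icc (0 : ℝ) 1)
    {w : FreqMomentum L M → ℝ} (hw : ∀ k, 0 ≤ w k ∧ w k ≤ 1 - hubbardCutoffWeightCT L M β μ K (klScale klE0 m) k)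
    (Wd : ℝ → FreqMomentum L M → ℝ) (hWd : Wd = fun t k => deriv (fun Λ' : ℝ => hubbardCutoffWeightCT L M β μ K Λ' k) (klScale klE0 n + t * (klScale klE0 (n + 1) - klScale klE0 n)))
    (F : FreqMomentum L M → Fin 2 → FreqMomentum L M → ℂ) (x y c : TorusSite 2 L) {ρ : ℝ} (hρ : 0 ≤ ρ) {A : ℝ} (hA : 0 ≤ A)
    (hF : ∀ (p : FreqMomentum L M) (σ : Fin 2) (p' : FreqMomentum L M), ‖F p σ p'‖ ≤ A)
    (hsupp : ∀ (p : FreqMomentum L M) (σ : Fin 2) (p' : FreqMomentum L M), ρ < klTorusNorm L (p.2 - c) → F p σ p' = 0) :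
    ‖∑ p : FreqMomentum L M, ∑ σ : Fin 2, ∑ p' : FreqMomentum L M,
        if matsubaraInt M p'.1 + matsubaraInt M (omega0 M) = matsubaraInt M p.1 + matsubaraInt M (omega0 M) ∧ p'.2 = p.2 + x - y then
          ((((((w p) : ℝ) : ℂ) * (((β * (L : ℝ) ^ 2 : ℝ) : ℂ) * propCT L M β μ K p)) * ((((Wd t p') : ℝ) : ℂ) * (((β * (L : ℝ) ^ 2 : ℝ) : ℂ) * propCT L M β μ K p'))) +
              (((((Wd t p) : ℝ) : ℂ) * (((β * (L : ℝ) ^ 2 : ℝ) : ℂ) * propCT L M β μ K p)) * ((((w p') : ℝ) : ℂ) * (((β * (L : ℝ) ^ 2 : ℝ) : ℂ) * propCT L M β μ K p')))) *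
            F p σ p'
        else 0‖ ≤
      A * (512 / 3 * (β * (L : ℝ) ^ 2) ^ 2 / (klScale klE0 n + t * (klScale klE0 (n + 1) - klScale klE0 n)) ^ 2 *
        (2 * (15381 * (ρ / π + ((L : ℝ))⁻¹) * klScale klE0 m * β * (L : ℝ) ^ 2))) := by
  have hβ0 : 0 < β := pos_of_klBetaMin_le hβ
  have hΛpos : 0 < klScale klE0 n + t * (klScale klE0 (n + 1) - klScale klE0 n) := (klth_klScale_pos (n + 1)).trans_le (scaleAt_mem n ht).1
  refine (klms_weighted_direct_norm_le_of_support β μ K hβ0 n ht w Wd hWd F x y c ρ hA hF hsupp).trans ?_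
  have h₁ := sum_window_softSymbol_mul_norm_propCT_le (M := M) β μ K hK hβ hβL m hw c hρ
  have h₂ := sum_window_softSymbol_mul_norm_propCT_le (M := M) β μ K hK hβ hβL m hw (c + (x - y)) hρ
  refine mul_le_mul_of_nonneg_left (mul_le_mul_of_nonneg_left ?_ (by positivity)) hA
  linarith [h₁, h₂]

/-- **WINDOW-SUPPORTED CROSSED ROW, SOFT WEIGHT**: `‖S‖ ≤ A·(256/3)(βL²)²/Λ(t)²·(2·(15381(ρ/π + 1/L)·Λ_m·βL²))`. -/
theorem klms_weighted_crossed_norm_le_of_support_soft {R : RenConsts} {U : ℝ} {N : ℕ} (hK : FrameOK R U N μ K) (hβ : klBetaMin ≤ β) (hβL : β ≤ L)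
    (n m : ℕ) {t : ℝ} (ht : t ∈ Icc (0 : ℝ) 1)
    {w : FreqMomentum L M → ℝ} (hw : ∀ k, 0 ≤ w k ∧ w k ≤ 1 - hubbardCutoffWeightCT L M β μ K (klScale klE0 m) k)
    (Wd : ℝ → FreqMomentum L M → ℝ) (hWd : Wd = fun t k => deriv (fun Λ' : ℝ => hubbardCutoffWeightCT L M β μ K Λ' k) (klScale klE0 n + t * (klScale klE0 (n + 1) - klScale klE0 n)))
    (F : FreqMomentum L M → FreqMomentum L M → ℂ) (Qm x y c : TorusSite 2 L) {ρ : ℝ} (hρ : 0 ≤ ρ) {A : ℝ} (hA : 0 ≤ A)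
    (hF : ∀ (p p' : FreqMomentum L M), ‖F p p'‖ ≤ A)
    (hsupp : ∀ (p p' : FreqMomentum L M), ρ < klTorusNorm L (p.2 - c) → F p p' = 0) :
    ‖∑ p : FreqMomentum L M, ∑ p' : FreqMomentum L M,
        if matsubaraInt M p'.1 + matsubaraInt M (omega0 M) + matsubaraInt M (omega0 M) + 1 = matsubaraInt M p.1 ∧ p'.2 = p.2 + Qm - x - y then
          ((((((w p) : ℝ) : ℂ) * (((β * (L : ℝ) ^ 2 : ℝ) : ℂ) * propCT L M β μ K p)) * ((((Wd t p') : ℝ) : ℂ) * (((β * (L : ℝ) ^ 2 : ℝ) : ℂ) * propCT L M β μ K p'))) +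
              (((((Wd t p) : ℝ) : ℂ) * (((β * (L : ℝ) ^ 2 : ℝ) : ℂ) * propCT L M β μ K p)) * ((((w p') : ℝ) : ℂ) * (((β * (L : ℝ) ^ 2 : ℝ) : ℂ) * propCT L M β μ K p')))) *
            F p p'
        else 0‖ ≤
      A * (256 / 3 * (β * (L : ℝ) ^ 2) ^ 2 / (klScale klE0 n + t * (klScale klE0 (n + 1) - klScale klE0 n)) ^ 2 *
        (2 * (15381 * (ρ / π + ((L : ℝ))⁻¹) * klScale klE0 m * β * (L : ℝ) ^ 2))) := by
  have hβ0 : 0 < β := pos_of_klBetaMin_le hβ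
  have hΛpos : 0 < klScale klE0 n + t * (klScale klE0 (n + 1) - klScale klE0 n) := (klth_klScale_pos (n + 1)).trans_le (scaleAt_mem n ht).1
  refine (klms_weighted_crossed_norm_le_of_support β μ K hβ0 n ht w Wd hWd F Qm x y c ρ hA hF hsupp).trans ?_
  have h₁ := sum_window_softSymbol_mul_norm_propCT_le (M := M) β μ K hK hβ hβL m hw c hρ
  have h₂ := sum_window_softSymbol_mul_norm_propCT_le (M := M) β μ K hK hβ hβL m hw (c + (Qm - x - y)) hρ
  refine mul_le_mul_of_nonneg_left (mul_le_mul_of_nonneg_left ?_ (by positivity)) hA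
  linarith [h₁, h₂]

/-! ## §4 The door's normalisation -/

omit [NeZero M] in
/-- **The window row in the door's normalisation**: for `C ≤ 512/3` (direct `512/3`, crossed `256/3`), `n+1 ≤ m`, `t ∈ [0,1]`:
`(Λₙ−Λₙ₊₁)((βL²)³)⁻¹·(A·(C(βL²)²/Λ(t)²·(2·(15381(ρ/π + 1/L)·Λ_m·βL²)))) ≤ A·(1024·15381)·(ρ/π + 1/L)` (`C` may be any real `≤ 512/3`) — with
`ρ = c_w·Λₙ₊₁` a `4^{−(n+1)}`-decaying plus a `1/L` entry (erem-shaped), NOT a flat one. -/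
theorem window_flat_le (hβ : 0 < β) (n : ℕ) {m : ℕ} (hm : n + 1 ≤ m) {t : ℝ} (ht : t ∈ Icc (0 : ℝ) 1)
    {A C ρ : ℝ} (hA : 0 ≤ A) (hC' : C ≤ 512 / 3) (hρ : 0 ≤ ρ) :
    (klScale klE0 n - klScale klE0 (n + 1)) * ((β * (L : ℝ) ^ 2) ^ 3)⁻¹ *
        (A * (C * (β * (L : ℝ) ^ 2) ^ 2 / (klScale klE0 n + t * (klScale klE0 (n + 1) - klScale klE0 n)) ^ 2 *
          (2 * (15381 * (ρ / π + ((L : ℝ))⁻¹) * klScale klE0 m * β * (L : ℝ) ^ 2)))) ≤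
      A * (1024 * 15381) * (ρ / π + ((L : ℝ))⁻¹) := by
  have hL : (0 : ℝ) < L := by exact_mod_cast Nat.pos_of_ne_zero (NeZero.ne L)
  have hBL : 0 < β * (L : ℝ) ^ 2 := by positivity
  obtain ⟨hlo, hhi⟩ := scaleAt_mem n ht
  have hΛ1 := klth_klScale_pos (n + 1)
  set Λt : ℝ := klScale klE0 n + t * (klScale klE0 (n + 1) - klScale klE0 n) with hΛt
  have hΛpos : 0 < Λt := hΛ1.trans_le hlo
  have hs : klScale klE0 n = 4 * klScale klE0 (n + 1) := by rw [klth_klScale_succ]; ring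
  have hmle : klScale klE0 m ≤ klScale klE0 (n + 1) := by
    unfold klScale
    exact mul_le_mul_of_nonneg_left (inv_anti₀ (by positivity) (pow_le_pow_right₀ (by norm_num) hm)) (by norm_num [klE0])
  have hm0 : 0 ≤ klScale klE0 m := (klth_klScale_pos m).le
  have hc0 : 0 ≤ ρ / π + ((L : ℝ))⁻¹ := by positivity
  -- `(Λₙ − Λₙ₊₁)·Λ_m ≤ 3·Λ(t)²`
  have hkey : (klScale klE0 n - klScale klE0 (n + 1)) * klScale klE0 m ≤ 3 * Λt ^ 2 := by
    have h1 : (klScale klE0 n - klScale klE0 (n + 1)) * klScale klE0 m ≤ 3 * klScale klE0 (n + 1) * klScale klE0 (n + 1) := by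
      rw [hs]; nlinarith
    have h2 : klScale klE0 (n + 1) * klScale klE0 (n + 1) ≤ Λt ^ 2 := by rw [sq]; exact mul_le_mul hlo hlo hΛ1.le hΛpos.le
    nlinarith
  -- rewrite the left side as `A·(2C·15381)·(ρ/π+1/L)·((Λₙ−Λₙ₊₁)Λ_m/Λ(t)²)`
  have e : (klScale klE0 n - klScale klE0 (n + 1)) * ((β * (L : ℝ) ^ 2) ^ 3)⁻¹ *
        (A * (C * (β * (L : ℝ) ^ 2) ^ 2 / Λt ^ 2 * (2 * (15381 * (ρ / π + ((L : ℝ))⁻¹) * klScale klE0 m * β * (L : ℝ) ^ 2)))) =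
      A * (2 * C * 15381) * (ρ / π + ((L : ℝ))⁻¹) * (((klScale klE0 n - klScale klE0 (n + 1)) * klScale klE0 m) / Λt ^ 2) := by
    field_simp
  rw [e]
  have hfrac : ((klScale klE0 n - klScale klE0 (n + 1)) * klScale klE0 m) / Λt ^ 2 ≤ 3 := by
    rw [div_le_iff₀ (by positivity)]; exact hkey
  have hfrac0 : 0 ≤ ((klScale klE0 n - klScale klE0 (n + 1)) * klScale klE0 m) / Λt ^ 2 := by
    apply div_nonneg _ (by positivity)
    exact mul_nonneg (by rw [hs]; linarith) hm0
  calc A * (2 * C * 15381) * (ρ / π + ((L : ℝ))⁻¹) * ((klScale klE0 n - klScale klE0 (n + 1)) * klScale klE0 m / Λt ^ 2)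
      ≤ A * (2 * (512 / 3) * 15381) * (ρ / π + ((L : ℝ))⁻¹) * 3 := by
        refine mul_le_mul ?_ hfrac hfrac0 (by positivity)
        refine mul_le_mul_of_nonneg_right (mul_le_mul_of_nonneg_left ?_ hA) hc0
        nlinarith
    _ = A * (1024 * 15381) * (ρ / π + ((L : ℝ))⁻¹) := by ring

end Summit.HubbardSuperconductivity.HubbardSuperconductivity.Theorems.KLRegimeSplit

end
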